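/-
Copyright (c) 2026 the pub-hodgecm-mathlib formalisation cell (harness21).  Prover seat hodgecm-mathlib-B-p10 (g25), (F11-c) LAYER B′ FILE 3 (iii) — FILE β-A
(the anisotropic frame: forms and valuations), design pen A-p13 (g30), architect A-p06 (g26), 2026-09-01.
-/
import Literature.NumberTheory.Automorphic.UnitaryThreeAnisotropicFixedPointRegimes   -- ★ (ii-b) B-p14 p841739: regimes; brings ★ Bounds, `LocalConjDatum`
import HarnessLib

/-!
# Flicker's Proposition 16, step (iii-a): the second fixed-point congruence as a function of `u = q∕s`, its twisted anti-trace form, and its valuations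
# (Flicker 1998, Prop. 16 p. 96, second row — regime `[N∕2] < m ≤ N`)

Topic `NumberTheory/Automorphic`; namespace `Literature.NumberTheory.Automorphic.UnitaryGroup`.  THEOREMS ONLY (no `def`, no instance, no notation, no named fact, no
`sorry`); kernel lane; count-neutral.  Cell `pub/hodgecm-mathlib`, crux H413, line «N7nsCount», value stub `stub_irredGValueNeg` (κ = −1), LAYER B′ FILE 3 (iii)
(B-p10 (g25); census `F0/P3a/B-p10/g25/CENSUS-F3iii-RegimeTwoCount.B-p10g25.md`; design pen A-p13 (g30) DESIGN v3).  HONEST LABEL: HC_CM is proved only modulo the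
printed citations until rung 0 closes; this file is field and valuation algebra for ONE regime of ONE value stub of #103-ns; the COUNT is the sequel
`UnitaryThreeAnisotropicFixedPointRegimeTwo` (over ★ `LocalFields/UnramifiedQuadraticNormTwistedAntitrace`).

THE MATHEMATICS.  Frame and sizes as in ★ (ii-b) `UnitaryThreeAnisotropicFixedPointRegimes`: `t ∈ Stab(w₀)` of type (2) has model entries `A_t, s_t` (units with
`N(A_t) = N(s_t)`, `N(s_t) + 4ϖN(q_t) = 1`), `|q_t| = |ϖ|^N`, `|A_t − s_t| ≤ |ϖ|^{N+1}`; a coset of `Stab(w₀) ⧸ H′_m` has coordinates `(q, s)` with `|s| = 1`,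
`|q| ≤ 1`, `N(s) + 4ϖN(q) = 1`, and its `q∕s`-class mod `𝔭^m` is the first coset invariant (★ A-p13 FILE 2d∕2e).  Expression 2 of the fixed-point criterion is (★ (ii-b))
`Δ_h·E(q,s)`, `E(q,s) = (A_t − 1) − 4ϖ(A_t − s_t)(σq·q) − 4ϖ(q_t·σq·s − (A_t∕σs_t)(σq_t·q·σs))`, `|Δ_h| = 1`.  In Flicker's own (equal-diagonal) frame the congruence
is affine σ-semilinear; in this frame `A_t ≠ s_t` and the quadratic term `4ϖ(A_t − s_t)N(q)` survives — it is absorbed EXACTLY by the twisted form below.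
* §1 `fixedPoint_expr00_eq_uForm`: **`E(q,s) = E_t(q∕s)`** EXACTLY, where `E_t(u)` is `E` with `σq·q ↦ N(u)ν(u)`, `σq·s ↦ σu·ν(u)`, `q·σs ↦ u·ν(u)`,
  `ν(u) = (1 + 4ϖ·uσu)⁻¹` (`= N(s)` by (U2)) — so condition 2 is a function of the class invariant `u = q∕s` alone (ι-free);
  `uForm_eq_twisted`: **`E_t(u) = (A_t − 1) − 2ϖ^{N+1}·Λ(Φ_t u)`**, `Λ(z) := z − Δ·σz`, `Δ := A_t∕σs_t` (`N(Δ) = 1`), `Φ_t(u) := ν(u)·(2ε·σu + e·uσu)` with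
  `q_t = ϖ^N ε`, `A_t − s_t = ϖ^N e` — because `A_t − s_t` lies EXACTLY on the image line `{Δσw = −w}` of `Λ` (`mul_map_sub_eq_neg`, uses `N(A_t) = N(s_t)`);
  `twist_numerator_eq`: `(A_t − 1)σs_t + A_t(σA_t − 1) = −4ϖN(q_t) + (σs_t − 1)(A_t − 1)`; `phiT_sub_sub_eq`: the difference identity of `Φ_t`.
* §2 valuations (`hd : LocalConjDatum σ ϖ`): `Φ_t` is integral (`v_phiT_le_one`) and a CONTRACTION PERTURBATION of `u ↦ 2ε·σu` (`v_phiT_sub_phiT_sub_le`: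
  `|Φ_t u − Φ_t u′ − 2ε(σu − σu′)| ≤ |ϖ|·|u − u′|`); `v_uForm_sub_uForm_le` ∕ **`uForm_le_iff_of_close`**: condition 2 is constant on classes `|u − u′| ≤ |ϖ^j|` as
  soon as `2m ≤ N + j`; **`v_twist_le_of_regimeTwo`**: solvability `|c + Δσc| ≤ |ϖ|^N`, `c = (A_t − 1)∕(2ϖ^{N+1})`, when `|A_t − 1| ≤ |ϖ|^{N+1}`;
  **`not_uForm_le_of_v_sub_one_eq`**: if `|A_t − 1| = |ϖ^M|`, `M ≤ N`, `M ≤ 2m`, NO class satisfies condition 2 (Prop. 16: the second row needs `N ≤ N₂`).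

## References
* [Flicker1998UnitaryFL] Y. Z. Flicker, *Elementary proof of the fundamental lemma for a unitary group*, Canad. J. Math. 50 (1998), Prop. 16 p. 96.
* [Serre1979] J.-P. Serre, *Local Fields*, GTM 67 (1979), Ch. V §2, Ch. X §1.
-/

set_option autoImplicit false

noncomputable section

open scoped WithZero Valued

namespace Literature.NumberTheory.Automorphic

namespace UnitaryGroup

open Literature.NumberTheory.Automorphic.HermitianLattice

variable {K : Type*} [Field K] [Valued K ℤᵐ⁰] {ϖ : K} (σ : K →+* K)

/-! ## §1 Algebra: expression 2 as a function of `u = q∕s`, and its twisted anti-trace form -/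

section Algebra

omit [Valued K ℤᵐ⁰] in
/-- **`E(q,s) = E_t(q∕s)`**: under the unitarity relation `σs·s + 4ϖ(σq·q) = 1` (so `N(s) = (1 + 4ϖN(q∕s))⁻¹`), expression 2 of ★ `fixedPoint_mem_unitaryInt_iff` ∕ ★
`fixedPoint_cond00_iff_of_two_mul_le` is a function of `u = q∕s` alone. [cite: Flicker1998UnitaryFL, Prop. 16 p. 96 («replacing `c` by `c∕a`»)] -/
theorem fixedPoint_expr00_eq_uForm (hσσ : ∀ x, σ (σ x) = x) (ϖ At st qt Δ : K) {s q : K} (hU2 : σ s * s + 4 * ϖ * (σ q * q) = 1) (hs : s ≠ 0) :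
    (At - 1) - 4 * ϖ * (At - st) * (σ q * q) - 4 * ϖ * (qt * σ q * s - Δ * (σ qt * q * σ s)) =
      (At - 1) - 4 * ϖ * (At - st) * ((q / s * σ (q / s)) * (1 + 4 * ϖ * (q / s * σ (q / s)))⁻¹) -
        4 * ϖ * ((1 + 4 * ϖ * (q / s * σ (q / s)))⁻¹ * (qt * σ (q / s) - Δ * (σ qt * (q / s)))) := by
  have hσs : σ s ≠ 0 := fun h => hs (by rw [← hσσ s, h, map_zero])
  have h1 : s * (q / s) = q := by field_simp
  have h2 : σ s * (σ q / σ s) = σ q := by field_simp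
  have h3 : (σ s * s) * (1 + 4 * ϖ * (q / s * (σ q / σ s))) = 1 := by
    calc (σ s * s) * (1 + 4 * ϖ * (q / s * (σ q / σ s))) = σ s * s + 4 * ϖ * ((σ s * (σ q / σ s)) * (s * (q / s))) := by ring
      _ = 1 := by rw [h1, h2]; linear_combination hU2
  have hν : (1 + 4 * ϖ * (q / s * σ (q / s)))⁻¹ = σ s * s := by
    rw [map_div₀]; exact (eq_inv_of_mul_eq_one_left h3).symm
  rw [hν, map_div₀]
  calc (At - 1) - 4 * ϖ * (At - st) * (σ q * q) - 4 * ϖ * (qt * σ q * s - Δ * (σ qt * q * σ s))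
      = (At - 1) - 4 * ϖ * (At - st) * ((s * (q / s)) * (σ s * (σ q / σ s))) -
          4 * ϖ * (qt * (σ s * (σ q / σ s)) * s - Δ * (σ qt * (s * (q / s)) * σ s)) := by rw [h1, h2]; ring
    _ = _ := by ring

omit [Valued K ℤᵐ⁰] in
/-- `A_t − s_t` lies on the image line of `Λ = 1 − Δσ`, `Δ = A_t∕σs_t`: `Δ·σ(A_t − s_t) = −(A_t − s_t)` when `N(A_t) = N(s_t)`; hence for σ-fixed `λ`,
`(A_t − s_t)·λ = Λ((A_t − s_t)·λ) ∕ 2`-free form: `2·(A_t − s_t)·λ = w − Δ·σw` with `w = (A_t − s_t)·λ·…` — stated as the identity used below.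
[cite: Flicker1998UnitaryFL, Prop. 16 p. 96] -/
theorem mul_map_sub_eq_neg (hσσ : ∀ x, σ (σ x) = x) {At st : K} (hNt : σ At * At = σ st * st) (hst : st ≠ 0) :
    At / σ st * σ (At - st) = -(At - st) := by
  have hσst : σ st ≠ 0 := fun h => hst (by rw [← hσσ st, h, map_zero])
  have h1 : At / σ st * σ At = st := by
    rw [div_mul_eq_mul_div, div_eq_iff hσst]
    linear_combination hNt
  rw [map_sub, mul_sub, h1, div_mul_cancel₀ At hσst]
  ring

omit [Valued K ℤᵐ⁰] in
/-- **`E_t(u) = (A_t − 1) − 2ϖ^{N+1}·Λ(Φ_t u)`** with `Λ(z) = z − (A_t∕σs_t)·σz`, `Φ_t u = (1 + 4ϖ uσu)⁻¹·(2ε·σu + e·uσu)`, `q_t = ϖ^N ε`, `A_t − s_t = ϖ^N e`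
(needs only `σσ = id`, `σϖ = ϖ`, `N(A_t) = N(s_t)`: the inverse is never cancelled). [cite: Flicker1998UnitaryFL, Prop. 16 p. 96] -/
theorem uForm_eq_twisted (hσσ : ∀ x, σ (σ x) = x) (hσϖ : σ ϖ = ϖ) {At st qt ε e : K} (hNt : σ At * At = σ st * st) (hst : st ≠ 0)
    (N : ℕ) (hε : qt = ϖ ^ N * ε) (he : At - st = ϖ ^ N * e) (u : K) :
    (At - 1) - 4 * ϖ * (At - st) * ((u * σ u) * (1 + 4 * ϖ * (u * σ u))⁻¹) -
        4 * ϖ * ((1 + 4 * ϖ * (u * σ u))⁻¹ * (qt * σ u - At / σ st * (σ qt * u))) =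
      (At - 1) - 2 * ϖ ^ (N + 1) *
        ((1 + 4 * ϖ * (u * σ u))⁻¹ * (2 * ε * σ u + e * (u * σ u)) -
          At / σ st * σ ((1 + 4 * ϖ * (u * σ u))⁻¹ * (2 * ε * σ u + e * (u * σ u)))) := by
  have hσst : σ st ≠ 0 := fun h => hst (by rw [← hσσ st, h, map_zero])
  have hline : At / σ st * σ e * ϖ ^ N = -(e * ϖ ^ N) := by
    have h1 := mul_map_sub_eq_neg σ hσσ hNt hst
    rw [he, map_mul, map_pow, hσϖ] at h1
    linear_combination h1
  have hσν : σ ((1 + 4 * ϖ * (u * σ u))⁻¹) = (1 + 4 * ϖ * (u * σ u))⁻¹ := by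
    rw [map_inv₀, map_add, map_one, map_mul, map_mul, map_ofNat, hσϖ, map_mul, hσσ, mul_comm (σ u) u]
  have hσqt : σ qt = ϖ ^ N * σ ε := by rw [hε, map_mul, map_pow, hσϖ]
  rw [map_mul σ ((1 + 4 * ϖ * (u * σ u))⁻¹), hσν, map_add, map_mul, map_mul, map_ofNat, hσσ, map_mul, map_mul, hσσ, mul_comm (σ u) u,
    hσqt, hε, he, pow_succ]
  linear_combination (-2 * ϖ * (1 + 4 * ϖ * (u * σ u))⁻¹ * (u * σ u)) * hline

omit [Valued K ℤᵐ⁰] in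
/-- **The solvability numerator**: `(A_t − 1)σs_t + A_t(σA_t − 1) = −4ϖ(σq_t·q_t) + (σs_t − 1)(A_t − 1)` from `N(A_t) = N(s_t)` and `N(s_t) + 4ϖN(q_t) = 1`.
[cite: Flicker1998UnitaryFL, Prop. 16 p. 96 («`β − δ₁ ∈ π^{1+2m}R` … hence `m ≤ N₂`»)] -/
theorem twist_numerator_eq {At st qt : K} (ϖ : K) (hNt : σ At * At = σ st * st) (hU2t : σ st * st + 4 * ϖ * (σ qt * qt) = 1) :
    (At - 1) * σ st + At * (σ At - 1) = -(4 * ϖ * (σ qt * qt)) + (σ st - 1) * (At - 1) := by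
  linear_combination hNt + hU2t

omit [Valued K ℤᵐ⁰] in
/-- `c + Δ·σc` for `c = x ∕ d` with `σd = d`: `x∕d + (A_t∕σs_t)·σ(x∕d) = ((A_t − 1)σs_t + A_t(σA_t − 1))·(σs_t·d)⁻¹` at `x = A_t − 1`. [cite: Flicker1998UnitaryFL, Prop. 16 p. 96] -/
theorem twist_apply_const_eq (hσσ : ∀ x, σ (σ x) = x) {At st d : K} (hst : st ≠ 0) (hd0 : d ≠ 0) (hσd : σ d = d) :
    (At - 1) / d + At / σ st * σ ((At - 1) / d) = ((At - 1) * σ st + At * (σ At - 1)) / (σ st * d) := by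
  have hσst : σ st ≠ 0 := fun h => hst (by rw [← hσσ st, h, map_zero])
  rw [map_div₀, map_sub, map_one, hσd]
  field_simp

omit [Valued K ℤᵐ⁰] in
/-- The difference identity behind the contraction estimate: with `ν = (1 + 4ϖN)⁻¹`, `g = e − 8ϖε·σu`: `Φ_t u − 2ε·σu = ν·N·g`, and
`(Φ_t u − 2εσu) − (Φ_t u′ − 2εσu′) = ν ν′·[N(g − g′)(1 + 4ϖN′) + (N − N′)g′]`. [cite: Flicker1998UnitaryFL, Prop. 16 p. 96] -/
theorem phiT_sub_sub_eq (ϖ : K) {ε e u u' : K} (hν : 1 + 4 * ϖ * (u * σ u) ≠ 0) (hν' : 1 + 4 * ϖ * (u' * σ u') ≠ 0) :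
    (1 + 4 * ϖ * (u * σ u))⁻¹ * (2 * ε * σ u + e * (u * σ u)) - (1 + 4 * ϖ * (u' * σ u'))⁻¹ * (2 * ε * σ u' + e * (u' * σ u')) -
        2 * ε * (σ u - σ u') =
      (1 + 4 * ϖ * (u * σ u))⁻¹ * (1 + 4 * ϖ * (u' * σ u'))⁻¹ *
        ((u * σ u) * ((e - 8 * ϖ * ε * σ u) - (e - 8 * ϖ * ε * σ u')) * (1 + 4 * ϖ * (u' * σ u')) +
          (u * σ u - u' * σ u') * (e - 8 * ϖ * ε * σ u')) := by
  have ha : (1 + 4 * ϖ * (u * σ u))⁻¹ * (1 + 4 * ϖ * (u * σ u)) = 1 := inv_mul_cancel₀ hν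
  have hb : (1 + 4 * ϖ * (u' * σ u'))⁻¹ * (1 + 4 * ϖ * (u' * σ u')) = 1 := inv_mul_cancel₀ hν'
  linear_combination ((1 + 4 * ϖ * (u' * σ u'))⁻¹ * (u' * σ u') * (e - 8 * ϖ * ε * σ u') + 2 * ε * σ u) * ha -
    ((1 + 4 * ϖ * (u * σ u))⁻¹ * (u * σ u) * (e - 8 * ϖ * ε * σ u) + 2 * ε * σ u') * hb

end Algebra

/-! ## §2 Valuations: integrality and contraction of `Φ_t`, constancy of condition 2 on classes, solvability, the zero case -/

section Valuations

variable (hd : LocalConjDatum σ ϖ)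
include hd

/-- `|4| = 1` and `|8| = 1` (non-dyadic). [cite: Flicker1998UnitaryFL, §1 p. 75 (`p ≠ 2`)] -/
private theorem v_four_eight : Valued.v (4 : K) = 1 ∧ Valued.v (8 : K) = 1 := by
  constructor
  · rw [show (4 : K) = 2 * 2 by norm_num, map_mul, hd.v2, one_mul]
  · rw [show (8 : K) = 2 * 2 * 2 by norm_num, map_mul, map_mul, hd.v2, one_mul, one_mul]

/-- `|1 + 4ϖ·uσu| = 1` for `|u| ≤ 1` (in particular it is non-zero). [cite: Flicker1998UnitaryFL, Prop. 4 p. 82] -/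
theorem v_one_add_norm_eq_one {u : K} (hu : Valued.v u ≤ 1) : Valued.v (1 + 4 * ϖ * (u * σ u)) = 1 := by
  have hlt : Valued.v (4 * ϖ * (u * σ u)) < 1 := by
    rw [map_mul, map_mul, (v_four_eight σ hd).1, one_mul, hd.vϖ, map_mul, hd.vσ]
    calc WithZero.exp (-1 : ℤ) * (Valued.v u * Valued.v u) ≤ WithZero.exp (-1 : ℤ) * (1 * 1) := mul_le_mul' le_rfl (mul_le_mul' hu hu)
      _ < 1 := by rw [mul_one, mul_one, ← WithZero.exp_zero, WithZero.exp_lt_exp]; norm_num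
  rw [Valuation.map_add_eq_of_lt_left _ (by rwa [Valuation.map_one]), Valuation.map_one]

/-- `1 + 4ϖ·uσu ≠ 0` for `|u| ≤ 1`. [cite: Flicker1998UnitaryFL, Prop. 4 p. 82] -/
theorem one_add_norm_ne_zero {u : K} (hu : Valued.v u ≤ 1) : 1 + 4 * ϖ * (u * σ u) ≠ 0 := fun h => by
  have := v_one_add_norm_eq_one σ hd hu
  rw [h, map_zero] at this
  exact zero_ne_one this

/-- **`Φ_t` is integral**: `|Φ_t u| ≤ 1` for `|u| ≤ 1`, `|ε| ≤ 1`, `|e| ≤ 1`. [cite: Flicker1998UnitaryFL, Prop. 16 p. 96] -/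
theorem v_phiT_le_one {ε e u : K} (hε : Valued.v ε ≤ 1) (he : Valued.v e ≤ 1) (hu : Valued.v u ≤ 1) :
    Valued.v ((1 + 4 * ϖ * (u * σ u))⁻¹ * (2 * ε * σ u + e * (u * σ u))) ≤ 1 := by
  have hσu : Valued.v (σ u) ≤ 1 := by rw [hd.vσ]; exact hu
  rw [map_mul, map_inv₀, v_one_add_norm_eq_one σ hd hu, inv_one, one_mul]
  refine Valuation.map_add_le _ ?_ ?_
  · rw [map_mul, map_mul, hd.v2, one_mul]; exact mul_le_one' hε hσu
  · rw [map_mul, map_mul]; exact mul_le_one' he (mul_le_one' hu hσu)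

/-- **`Φ_t` is a contraction perturbation of `u ↦ 2ε·σu`**: `|Φ_t u − Φ_t u′ − 2ε(σu − σu′)| ≤ |ϖ|·|u − u′|` for `|u|, |u′| ≤ 1`, `|ε| ≤ 1`, `|e| ≤ |ϖ|`.
[cite: Flicker1998UnitaryFL, Prop. 16 p. 96] -/
theorem v_phiT_sub_phiT_sub_le {ε e u u' : K} (hε : Valued.v ε ≤ 1) (he : Valued.v e ≤ Valued.v ϖ) (hu : Valued.v u ≤ 1) (hu' : Valued.v u' ≤ 1) :
    Valued.v ((1 + 4 * ϖ * (u * σ u))⁻¹ * (2 * ε * σ u + e * (u * σ u)) - (1 + 4 * ϖ * (u' * σ u'))⁻¹ * (2 * ε * σ u' + e * (u' * σ u')) -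
        2 * ε * (σ u - σ u')) ≤ Valued.v ϖ * Valued.v (u - u') := by
  have h48 := v_four_eight σ hd
  have hσu : Valued.v (σ u) ≤ 1 := by rw [hd.vσ]; exact hu
  have hσu' : Valued.v (σ u') ≤ 1 := by rw [hd.vσ]; exact hu'
  have hN : Valued.v (u * σ u) ≤ 1 := by rw [map_mul]; exact mul_le_one' hu hσu
  have hdσ : Valued.v (σ u - σ u') = Valued.v (u - u') := by rw [← map_sub, hd.vσ]
  -- `|g′| ≤ |ϖ|`
  have hg' : Valued.v (e - 8 * ϖ * ε * σ u') ≤ Valued.v ϖ := by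
    refine Valuation.map_sub_le _ he ?_
    rw [map_mul, map_mul, map_mul, h48.2, one_mul]
    calc Valued.v ϖ * Valued.v ε * Valued.v (σ u') ≤ Valued.v ϖ * 1 * 1 := mul_le_mul' (mul_le_mul' le_rfl hε) hσu'
      _ = Valued.v ϖ := by rw [mul_one, mul_one]
  -- `|g − g′| ≤ |ϖ|·|u − u′|`
  have hgg : Valued.v ((e - 8 * ϖ * ε * σ u) - (e - 8 * ϖ * ε * σ u')) ≤ Valued.v ϖ * Valued.v (u - u') := by
    rw [show (e - 8 * ϖ * ε * σ u) - (e - 8 * ϖ * ε * σ u') = -(8 * ε) * (ϖ * (σ u - σ u')) by ring, map_mul, Valuation.map_neg, map_mul, h48.2,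
      one_mul, map_mul, hdσ]
    calc Valued.v ε * (Valued.v ϖ * Valued.v (u - u')) ≤ 1 * (Valued.v ϖ * Valued.v (u - u')) := mul_le_mul' hε le_rfl
      _ = _ := one_mul _
  -- `|N − N′| ≤ |u − u′|`
  have hNN : Valued.v (u * σ u - u' * σ u') ≤ Valued.v (u - u') := by
    rw [show u * σ u - u' * σ u' = (u - u') * σ u + u' * (σ u - σ u') by ring]
    refine Valuation.map_add_le _ ?_ ?_
    · rw [map_mul]
      calc Valued.v (u - u') * Valued.v (σ u) ≤ Valued.v (u - u') * 1 := mul_le_mul' le_rfl hσu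
        _ = _ := mul_one _
    · rw [map_mul, hdσ]
      calc Valued.v u' * Valued.v (u - u') ≤ 1 * Valued.v (u - u') := mul_le_mul' hu' le_rfl
        _ = _ := one_mul _
  rw [phiT_sub_sub_eq σ ϖ (one_add_norm_ne_zero σ hd hu) (one_add_norm_ne_zero σ hd hu'), map_mul, map_mul, map_inv₀, map_inv₀,
    v_one_add_norm_eq_one σ hd hu, v_one_add_norm_eq_one σ hd hu', inv_one, one_mul, one_mul]
  refine Valuation.map_add_le _ ?_ ?_
  · rw [map_mul, map_mul, v_one_add_norm_eq_one σ hd hu', mul_one]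
    calc Valued.v (u * σ u) * Valued.v ((e - 8 * ϖ * ε * σ u) - (e - 8 * ϖ * ε * σ u')) ≤ 1 * (Valued.v ϖ * Valued.v (u - u')) :=
          mul_le_mul' hN hgg
      _ = _ := one_mul _
  · rw [map_mul, mul_comm (Valued.v ϖ)]
    exact mul_le_mul' hNN hg'

/-- Consequently `|Φ_t u − Φ_t u′| ≤ |u − u′|` (`|2ε| ≤ 1`, ultrametric). [cite: Flicker1998UnitaryFL, Prop. 16 p. 96] -/
theorem v_phiT_sub_phiT_le {ε e u u' : K} (hε : Valued.v ε ≤ 1) (he : Valued.v e ≤ Valued.v ϖ) (hu : Valued.v u ≤ 1) (hu' : Valued.v u' ≤ 1) :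
    Valued.v ((1 + 4 * ϖ * (u * σ u))⁻¹ * (2 * ε * σ u + e * (u * σ u)) - (1 + 4 * ϖ * (u' * σ u'))⁻¹ * (2 * ε * σ u' + e * (u' * σ u'))) ≤
      Valued.v (u - u') := by
  have h := v_phiT_sub_phiT_sub_le σ hd hε he hu hu'
  have h2 : Valued.v (2 * ε * (σ u - σ u')) ≤ Valued.v (u - u') := by
    rw [map_mul, map_mul, hd.v2, one_mul, ← map_sub, hd.vσ]
    calc Valued.v ε * Valued.v (u - u') ≤ 1 * Valued.v (u - u') := mul_le_mul' hε le_rfl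
      _ = _ := one_mul _
  have h1 : Valued.v ϖ * Valued.v (u - u') ≤ Valued.v (u - u') := by
    calc Valued.v ϖ * Valued.v (u - u') ≤ 1 * Valued.v (u - u') :=
          mul_le_mul' (by rw [hd.vϖ, ← WithZero.exp_zero, WithZero.exp_le_exp]; norm_num) le_rfl
      _ = _ := one_mul _
  have e0 : (1 + 4 * ϖ * (u * σ u))⁻¹ * (2 * ε * σ u + e * (u * σ u)) - (1 + 4 * ϖ * (u' * σ u'))⁻¹ * (2 * ε * σ u' + e * (u' * σ u')) =
      ((1 + 4 * ϖ * (u * σ u))⁻¹ * (2 * ε * σ u + e * (u * σ u)) - (1 + 4 * ϖ * (u' * σ u'))⁻¹ * (2 * ε * σ u' + e * (u' * σ u')) -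
        2 * ε * (σ u - σ u')) + 2 * ε * (σ u - σ u') := by ring
  rw [e0]
  exact Valuation.map_add_le _ (h.trans h1) h2

/-- `|Λ z − Λ z′| ≤ |z − z′|` for `Λ(z) = z − Δσz` with `|Δ| ≤ 1`. [cite: Flicker1998UnitaryFL, Prop. 16 p. 96] -/
theorem v_twisted_sub_twisted_le {Δ z z' : K} (hΔ : Valued.v Δ ≤ 1) :
    Valued.v ((z - Δ * σ z) - (z' - Δ * σ z')) ≤ Valued.v (z - z') := by
  rw [show (z - Δ * σ z) - (z' - Δ * σ z') = (z - z') + -(Δ * (σ z - σ z')) by ring]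
  refine Valuation.map_add_le _ le_rfl ?_
  rw [Valuation.map_neg, map_mul, ← map_sub, hd.vσ]
  calc Valued.v Δ * Valued.v (z - z') ≤ 1 * Valued.v (z - z') := mul_le_mul' hΔ le_rfl
    _ = _ := one_mul _

/-- The sizes of the type-(2) data in the `(ε, e)` normalisation: `|ε| = 1`, `|e| ≤ |ϖ|` from `|q_t| = |ϖ|^N`, `|A_t − s_t| ≤ |ϖ|^{N+1}`. [cite: Flicker1998UnitaryFL, Prop. 16 p. 96] -/
theorem v_eps_e_of_sizes {At st qt ε e : K} (N : ℕ) (hε : qt = ϖ ^ N * ε) (he : At - st = ϖ ^ N * e)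
    (hqt : Valued.v qt = WithZero.exp (-(N : ℤ))) (hAst : Valued.v (At - st) ≤ WithZero.exp (-((N : ℤ) + 1))) :
    Valued.v ε = 1 ∧ Valued.v e ≤ Valued.v ϖ := by
  have hϖN : Valued.v (ϖ ^ N) ≠ 0 := by rw [hd.v_pow]; exact WithZero.coe_ne_zero
  constructor
  · rw [hε, map_mul, hd.v_pow] at hqt
    have : WithZero.exp (-(N : ℤ)) * Valued.v ε = WithZero.exp (-(N : ℤ)) * 1 := by rw [mul_one]; exact hqt
    exact mul_left_cancel₀ (by rw [← hd.v_pow]; exact hϖN) this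
  · rw [he, map_mul, hd.v_pow, show -((N : ℤ) + 1) = -(N : ℤ) + (-1) by ring, WithZero.exp_add, mul_comm (WithZero.exp (-(N : ℤ))) (Valued.v e),
      mul_comm (WithZero.exp (-(N : ℤ))) _] at hAst
    rw [hd.vϖ]
    exact le_of_mul_le_mul_right hAst (zero_lt_iff.2 WithZero.coe_ne_zero)

/-- **Condition 2 moves by at most `|ϖ|^{N+1}·|u − u′|`**: `|E_t u − E_t u′| ≤ |ϖ^{N+1}|·|u − u′|` (through the twisted form: `|2ϖ^{N+1}| = |ϖ|^{N+1}`,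
`|Λ(Φ_t u) − Λ(Φ_t u′)| ≤ |u − u′|`). [cite: Flicker1998UnitaryFL, Prop. 16 p. 96] -/
theorem v_uForm_sub_uForm_le {At st qt ε e : K} (hNt : σ At * At = σ st * st) (hAt : Valued.v At = 1) (hst1 : Valued.v st = 1) (N : ℕ)
    (hε : qt = ϖ ^ N * ε) (he : At - st = ϖ ^ N * e) (hqt : Valued.v qt = WithZero.exp (-(N : ℤ)))
    (hAst : Valued.v (At - st) ≤ WithZero.exp (-((N : ℤ) + 1))) {u u' : K} (hu : Valued.v u ≤ 1) (hu' : Valued.v u' ≤ 1) :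
    Valued.v (((At - 1) - 4 * ϖ * (At - st) * ((u * σ u) * (1 + 4 * ϖ * (u * σ u))⁻¹) -
          4 * ϖ * ((1 + 4 * ϖ * (u * σ u))⁻¹ * (qt * σ u - At / σ st * (σ qt * u)))) -
        ((At - 1) - 4 * ϖ * (At - st) * ((u' * σ u') * (1 + 4 * ϖ * (u' * σ u'))⁻¹) -
          4 * ϖ * ((1 + 4 * ϖ * (u' * σ u'))⁻¹ * (qt * σ u' - At / σ st * (σ qt * u'))))) ≤
      Valued.v (ϖ ^ (N + 1)) * Valued.v (u - u') := by
  have hst : st ≠ 0 := fun h => by rw [h, map_zero] at hst1; exact zero_ne_one hst1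
  obtain ⟨hvε, hve⟩ := v_eps_e_of_sizes σ hd N hε he hqt hAst
  have hΔ : Valued.v (At / σ st) ≤ 1 := by rw [map_div₀, hd.vσ, hAt, hst1, div_one]
  rw [uForm_eq_twisted σ hd.σσ hd.σϖ hNt hst N hε he u, uForm_eq_twisted σ hd.σσ hd.σϖ hNt hst N hε he u']
  rw [show ∀ a b x y : K, (a - b * x) - (a - b * y) = -(b * (x - y)) from fun a b x y => by ring, Valuation.map_neg, map_mul, map_mul, hd.v2, one_mul]
  refine mul_le_mul' le_rfl ((v_twisted_sub_twisted_le σ hd hΔ).trans ?_)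
  exact v_phiT_sub_phiT_le σ hd hvε.le hve hu hu'

/-- **Condition 2 is constant on classes**: if `|u − u′| ≤ |ϖ^j|` and `2m ≤ N + j` then `|E_t u| ≤ |ϖ^{2m+1}| ↔ |E_t u′| ≤ |ϖ^{2m+1}|` (take `j = m` when `m ≤ N`,
or `j = 2m − N`). [cite: Flicker1998UnitaryFL, Prop. 16 p. 96] -/
theorem uForm_le_iff_of_close {At st qt ε e : K} (hNt : σ At * At = σ st * st) (hAt : Valued.v At = 1) (hst1 : Valued.v st = 1) (N : ℕ)
    (hε : qt = ϖ ^ N * ε) (he : At - st = ϖ ^ N * e) (hqt : Valued.v qt = WithZero.exp (-(N : ℤ)))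
    (hAst : Valued.v (At - st) ≤ WithZero.exp (-((N : ℤ) + 1))) {m j : ℕ} (hj : 2 * m ≤ N + j)
    {u u' : K} (hu : Valued.v u ≤ 1) (hu' : Valued.v u' ≤ 1) (hclose : Valued.v (u - u') ≤ Valued.v (ϖ ^ j)) :
    Valued.v ((At - 1) - 4 * ϖ * (At - st) * ((u * σ u) * (1 + 4 * ϖ * (u * σ u))⁻¹) -
          4 * ϖ * ((1 + 4 * ϖ * (u * σ u))⁻¹ * (qt * σ u - At / σ st * (σ qt * u)))) ≤ Valued.v (ϖ ^ (2 * m + 1)) ↔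
      Valued.v ((At - 1) - 4 * ϖ * (At - st) * ((u' * σ u') * (1 + 4 * ϖ * (u' * σ u'))⁻¹) -
          4 * ϖ * ((1 + 4 * ϖ * (u' * σ u'))⁻¹ * (qt * σ u' - At / σ st * (σ qt * u')))) ≤ Valued.v (ϖ ^ (2 * m + 1)) := by
  have hdiff := v_uForm_sub_uForm_le σ hd hNt hAt hst1 N hε he hqt hAst hu hu'
  have hB : Valued.v (ϖ ^ (N + 1)) * Valued.v (u - u') ≤ Valued.v (ϖ ^ (2 * m + 1)) := by
    calc Valued.v (ϖ ^ (N + 1)) * Valued.v (u - u') ≤ Valued.v (ϖ ^ (N + 1)) * Valued.v (ϖ ^ j) := mul_le_mul' le_rfl hclose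
      _ ≤ Valued.v (ϖ ^ (2 * m + 1)) := by
        rw [← map_mul, ← pow_add, hd.v_pow, hd.v_pow, WithZero.exp_le_exp]; push_cast; omega
  have key := hdiff.trans hB
  set X := (At - 1) - 4 * ϖ * (At - st) * ((u * σ u) * (1 + 4 * ϖ * (u * σ u))⁻¹) -
    4 * ϖ * ((1 + 4 * ϖ * (u * σ u))⁻¹ * (qt * σ u - At / σ st * (σ qt * u)))
  set Y := (At - 1) - 4 * ϖ * (At - st) * ((u' * σ u') * (1 + 4 * ϖ * (u' * σ u'))⁻¹) -
    4 * ϖ * ((1 + 4 * ϖ * (u' * σ u'))⁻¹ * (qt * σ u' - At / σ st * (σ qt * u')))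
  constructor
  · intro hX
    have : Y = X + -(X - Y) := by ring
    rw [this]
    exact Valuation.map_add_le _ hX (by rwa [Valuation.map_neg])
  · intro hY
    have : X = Y + (X - Y) := by ring
    rw [this]
    exact Valuation.map_add_le _ hY key

/-- **Solvability**: `|(A_t − 1)σs_t + A_t(σA_t − 1)| ≤ |ϖ|^{2N+1}` when `|A_t − 1| ≤ |ϖ|^{N+1}`, `|A_t − s_t| ≤ |ϖ|^{N+1}`, `|q_t| = |ϖ|^N` (★ `twist_numerator_eq`).
[cite: Flicker1998UnitaryFL, Prop. 16 p. 96] -/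
theorem v_twist_numerator_le {At st qt : K} (hNt : σ At * At = σ st * st) (hU2t : σ st * st + 4 * ϖ * (σ qt * qt) = 1) (N : ℕ)
    (hqt : Valued.v qt = WithZero.exp (-(N : ℤ))) (hAst : Valued.v (At - st) ≤ WithZero.exp (-((N : ℤ) + 1)))
    (hA1 : Valued.v (At - 1) ≤ WithZero.exp (-((N : ℤ) + 1))) :
    Valued.v ((At - 1) * σ st + At * (σ At - 1)) ≤ WithZero.exp (-(2 * (N : ℤ) + 1)) := by
  have h48 := v_four_eight σ hd
  have hs1 : Valued.v (σ st - 1) ≤ WithZero.exp (-((N : ℤ) + 1)) := by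
    rw [show σ st - 1 = σ (st - 1) by rw [map_sub, map_one], hd.vσ, show st - 1 = (At - 1) - (At - st) by ring]
    exact Valuation.map_sub_le _ hA1 hAst
  rw [twist_numerator_eq σ ϖ hNt hU2t]
  refine Valuation.map_add_le _ ?_ ?_
  · rw [Valuation.map_neg, map_mul, map_mul, h48.1, one_mul, hd.vϖ, map_mul, hd.vσ, hqt, ← WithZero.exp_add, ← WithZero.exp_add, WithZero.exp_le_exp]
    omega
  · rw [map_mul]
    calc Valued.v (σ st - 1) * Valued.v (At - 1) ≤ WithZero.exp (-((N : ℤ) + 1)) * WithZero.exp (-((N : ℤ) + 1)) := mul_le_mul' hs1 hA1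
      _ ≤ _ := by rw [← WithZero.exp_add, WithZero.exp_le_exp]; omega

/-- **Solvability of the twisted congruence in regime 2**: for `c = (A_t − 1)∕(2ϖ^{N+1})`, `|c + (A_t∕σs_t)·σc| ≤ |ϖ^N|` (so `≤ |ϖ^k|` for `k = 2m − N ≤ N`).
[cite: Flicker1998UnitaryFL, Prop. 16 p. 96] -/
theorem v_twist_le_of_regimeTwo {At st qt : K} (hNt : σ At * At = σ st * st) (hU2t : σ st * st + 4 * ϖ * (σ qt * qt) = 1) (hst1 : Valued.v st = 1) (N : ℕ)
    (hqt : Valued.v qt = WithZero.exp (-(N : ℤ))) (hAst : Valued.v (At - st) ≤ WithZero.exp (-((N : ℤ) + 1)))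
    (hA1 : Valued.v (At - 1) ≤ WithZero.exp (-((N : ℤ) + 1))) :
    Valued.v ((At - 1) / (2 * ϖ ^ (N + 1)) + At / σ st * σ ((At - 1) / (2 * ϖ ^ (N + 1)))) ≤ Valued.v (ϖ ^ N) := by
  have hst : st ≠ 0 := fun h => by rw [h, map_zero] at hst1; exact zero_ne_one hst1
  have h2 : (2 : K) ≠ 0 := fun h => by have := hd.v2; rw [h, map_zero] at this; exact zero_ne_one this
  have hd0 : (2 : K) * ϖ ^ (N + 1) ≠ 0 := mul_ne_zero h2 (pow_ne_zero _ hd.ϖ_ne_zero)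
  have hσd : σ (2 * ϖ ^ (N + 1)) = 2 * ϖ ^ (N + 1) := by rw [map_mul, map_ofNat, map_pow, hd.σϖ]
  rw [twist_apply_const_eq σ hd.σσ hst hd0 hσd, map_div₀, map_mul, map_mul, hd.vσ, hst1, one_mul, hd.v2, one_mul, hd.v_pow, hd.v_pow,
    div_le_iff₀ (zero_lt_iff.2 WithZero.coe_ne_zero), ← WithZero.exp_add]
  refine (v_twist_numerator_le σ hd hNt hU2t N hqt hAst hA1).trans ?_
  rw [WithZero.exp_le_exp]; push_cast; omega

/-- **The zero case of regime 2** (`M ≤ N`, i.e. `N₂ < N`): if `|A_t − 1| = |ϖ^M|` with `M ≤ N` and `M ≤ 2m` then NO `u ∈ 𝒪` satisfies condition 2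
(`|E_t u| = |A_t − 1| > |ϖ^{2m+1}|`). [cite: Flicker1998UnitaryFL, Prop. 16 p. 96 (second row needs `N ≤ N₂`)] -/
theorem not_uForm_le_of_v_sub_one_eq {At st qt ε e : K} (hNt : σ At * At = σ st * st) (hAt : Valued.v At = 1) (hst1 : Valued.v st = 1) (N : ℕ)
    (hε : qt = ϖ ^ N * ε) (he : At - st = ϖ ^ N * e) (hqt : Valued.v qt = WithZero.exp (-(N : ℤ)))
    (hAst : Valued.v (At - st) ≤ WithZero.exp (-((N : ℤ) + 1))) {M m : ℕ} (hM : Valued.v (At - 1) = Valued.v (ϖ ^ M)) (hMN : M ≤ N)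
    (hM2 : M ≤ 2 * m) {u : K} (hu : Valued.v u ≤ 1) :
    ¬ Valued.v ((At - 1) - 4 * ϖ * (At - st) * ((u * σ u) * (1 + 4 * ϖ * (u * σ u))⁻¹) -
          4 * ϖ * ((1 + 4 * ϖ * (u * σ u))⁻¹ * (qt * σ u - At / σ st * (σ qt * u)))) ≤ Valued.v (ϖ ^ (2 * m + 1)) := by
  have hst : st ≠ 0 := fun h => by rw [h, map_zero] at hst1; exact zero_ne_one hst1
  obtain ⟨hvε, hve⟩ := v_eps_e_of_sizes σ hd N hε he hqt hAst
  have hΔ : Valued.v (At / σ st) ≤ 1 := by rw [map_div₀, hd.vσ, hAt, hst1, div_one]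
  rw [uForm_eq_twisted σ hd.σσ hd.σϖ hNt hst N hε he u]
  set z := (1 + 4 * ϖ * (u * σ u))⁻¹ * (2 * ε * σ u + e * (u * σ u)) with hz
  have hϖ1 : Valued.v ϖ ≤ 1 := by rw [hd.vϖ, ← WithZero.exp_zero, WithZero.exp_le_exp]; norm_num
  have hz1 : Valued.v z ≤ 1 := v_phiT_le_one σ hd hvε.le (hve.trans hϖ1) hu
  have hΛ : Valued.v (z - At / σ st * σ z) ≤ 1 := by
    refine Valuation.map_sub_le _ hz1 ?_
    rw [map_mul, hd.vσ]; exact mul_le_one' hΔ hz1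
  have hsmall : Valued.v (2 * ϖ ^ (N + 1) * (z - At / σ st * σ z)) < Valued.v (At - 1) := by
    rw [map_mul, map_mul, hd.v2, one_mul, hM, hd.v_pow, hd.v_pow]
    calc WithZero.exp (-((N + 1 : ℕ) : ℤ)) * Valued.v (z - At / σ st * σ z) ≤ WithZero.exp (-((N + 1 : ℕ) : ℤ)) * 1 := mul_le_mul' le_rfl hΛ
      _ < WithZero.exp (-(M : ℤ)) := by rw [mul_one, WithZero.exp_lt_exp]; push_cast; omega
  rw [show (At - 1) - 2 * ϖ ^ (N + 1) * (z - At / σ st * σ z) = (At - 1) + -(2 * ϖ ^ (N + 1) * (z - At / σ st * σ z)) from sub_eq_add_neg _ _,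
    Valuation.map_add_eq_of_lt_left _ (by rwa [Valuation.map_neg]), hM, hd.v_pow, hd.v_pow, not_le, WithZero.exp_lt_exp]
  push_cast; omega

end Valuations

end UnitaryGroup

end Literature.NumberTheory.Automorphic

end
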